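import Literature.AnabelianGeometry.EtaleTheta.ThetaCohomology
import Literature.AnabelianGeometry.EtaleTheta.ContH1CoeffEndo
import HarnessLib

/-!
# [EtTh] Prop. 1.5 (i)/(ii), first clause: `res_{Δ_Θ}` is ONTO `Hom(Δ_Θ, Δ_Θ)` from one lift of `log(Θ)` and the
# `Ẑ`-powers of the coefficients (proof-only reduction for the model-side census)

S. Mochizuki, *The étale theta function …*, Publ. RIMS **45** (2009), §1, Prop. 1.5 (i)/(ii) p. 23: "`F⁰/F¹ = Hom(Δ_Θ, Δ_Θ) =
Ẑ · log(Θ)`" [cite: MochizukiEtTh2009, Prop 1.5 p.23]. Layer L2 of the abc-iut cell, seat abc-iut-L2-t6 (gen 5), R78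
value layer (clause (a) of abc-iut-L2-t1's `Prop15i`/`Prop15ii` at the semi-synthetic models). PROOF-ONLY over
`ThetaCohomology` and this seat's `ContH1CoeffEndo` (`ContH1.mapEndo`, `res_mapEndo`).

`res_deltaTheta_surjective_of_lift`: if a class `x′ ∈ H¹(H, Δ_Θ)` (`H = (Π^tp_Y)^Θ` or `(Π^tp_Ÿ)^Θ`) restricts to
`log(Θ)` on `Δ_Θ`, and every class in `H¹(Δ_Θ, Δ_Θ)` is `e(log Θ)` for some continuous endomorphism `e` of `Δ_Θ`
commuting with the conjugation action of `H` (at the models: the `u`-th powers of `Δ_Θ ≅ Ẑ(χ)`, `u ∈ Ẑ` — "`Ẑ ·`"),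
then restriction `H¹(H, Δ_Θ) → H¹(Δ_Θ, Δ_Θ)` is surjective (`res (e·x′) = e·(res x′) = e·log Θ`). Nothing of [EtTh]
is asserted; no side taken on [IUTchIII] Cor. 3.12.
-/

noncomputable section

namespace Literature.AnabelianGeometry.EtaleTheta

namespace ThetaSetting

variable {p : ℕ} [Fact p.Prime] {D : ThetaSetting p}

/-- **`res_{Δ_Θ} : H¹(H, Δ_Θ) → Hom(Δ_Θ, Δ_Θ)` is surjective** as soon as `log(Θ)` lifts to `H` and every class on
`Δ_Θ` is the image of `log(Θ)` under an `H`-equivariant continuous endomorphism of `Δ_Θ` ("`F⁰/F¹ = Ẑ · log(Θ)`").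
[cite: MochizukiEtTh2009, Prop 1.5 p.23] -/
theorem res_deltaTheta_surjective_of_lift {H : Subgroup D.GtpTheta} (hle : D.DeltaTheta ≤ H) (x' : D.H1Theta H)
    (hres : ContH1.res (MonoidHom.id D.GtpTheta) D.DeltaTheta hle x' = D.logTheta)
    (hall : ∀ y : D.H1Theta D.DeltaTheta, ∃ (e : D.DeltaTheta →* D.DeltaTheta) (he : Continuous e)
      (hcomm : ∀ g : D.GtpTheta, g ∈ H → ∀ a : D.DeltaTheta,
        e (MulAut.conjNormal ((MonoidHom.id D.GtpTheta) g) a) = MulAut.conjNormal ((MonoidHom.id D.GtpTheta) g) (e a)),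
      y = ContH1.mapEndo (MonoidHom.id D.GtpTheta) D.DeltaTheta D.DeltaTheta e he
        (fun g hg a => hcomm g (hle hg) a) D.logTheta) :
    Function.Surjective (ContH1.res (MonoidHom.id D.GtpTheta) D.DeltaTheta hle : D.H1Theta H → D.H1Theta D.DeltaTheta) := by
  intro y
  obtain ⟨e, he, hcomm, rfl⟩ := hall y
  refine ⟨ContH1.mapEndo (MonoidHom.id D.GtpTheta) D.DeltaTheta H e he hcomm x', ?_⟩
  rw [ContH1.res_mapEndo, hres]

/-- The `Ÿ`-form: clause (a) of `Prop15ii` from a lift of `log(Θ)` to `(Π^tp_Ÿ)^Θ` and the `Ẑ`-powers.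
[cite: MochizukiEtTh2009, Prop 1.5 (ii) p.23] -/
theorem prop15ii_res_surjective_of_lift (hC : D.Compat) (x' : D.H1Theta (D.GtpYdd.map D.toTheta))
    (hres : ContH1.res (MonoidHom.id D.GtpTheta) D.DeltaTheta
      (hC.deltaTheta_le_DtpYddTheta.trans (Subgroup.map_mono inf_le_left)) x' = D.logTheta)
    (hall : ∀ y : D.H1Theta D.DeltaTheta, ∃ (e : D.DeltaTheta →* D.DeltaTheta) (he : Continuous e)
      (hcomm : ∀ g : D.GtpTheta, g ∈ D.GtpYdd.map D.toTheta → ∀ a : D.DeltaTheta,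
        e (MulAut.conjNormal ((MonoidHom.id D.GtpTheta) g) a) = MulAut.conjNormal ((MonoidHom.id D.GtpTheta) g) (e a)),
      y = ContH1.mapEndo (MonoidHom.id D.GtpTheta) D.DeltaTheta D.DeltaTheta e he
        (fun g hg a => hcomm g ((hC.deltaTheta_le_DtpYddTheta.trans (Subgroup.map_mono inf_le_left)) hg) a)
        D.logTheta) :
    Function.Surjective (ContH1.res (MonoidHom.id D.GtpTheta) D.DeltaTheta
      (hC.deltaTheta_le_DtpYddTheta.trans (Subgroup.map_mono inf_le_left)) :
      D.H1Theta (D.GtpYdd.map D.toTheta) → D.H1Theta D.DeltaTheta) :=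
  res_deltaTheta_surjective_of_lift _ x' hres hall

end ThetaSetting

end Literature.AnabelianGeometry.EtaleTheta

end
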